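import Summits.AtomisticToContinuum.HydrodynamicLimit.Theses.LindebergRandomFuture
import Summits.AtomisticToContinuum.HydrodynamicLimit.Theorems.LambertianContactSwapLambertianEulerOfHearts
import Summits.AtomisticToContinuum.HydrodynamicLimit.Theses.LambertianContactSwap
import Summits.AtomisticToContinuum.HydrodynamicLimit.Theorems.LambertianContactSwapLambertianEulerArchimedes
import Summits.AtomisticToContinuum.HydrodynamicLimit.Theorems.LambertianContactSwapLambertianEulerLambertLaw
import Summits.AtomisticToContinuum.HydrodynamicLimit.Theorems.LambertianContactSwapLambertianEulerPovzner
import Summits.AtomisticToContinuum.HydrodynamicLimit.Theorems.LambertianContactSwapLambertianEulerPairPovzner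
import Summits.AtomisticToContinuum.HydrodynamicLimit.Theorems.LambertianContactSwapLambertianEulerContactIsotropy
import Summits.AtomisticToContinuum.HydrodynamicLimit.Theorems.LambertianContactSwapLambertianEulerMomentLedgerChain
import Summits.AtomisticToContinuum.HydrodynamicLimit.Theorems.LambertianContactSwapLambertianEulerGibbsInvariance
import Summits.AtomisticToContinuum.HydrodynamicLimit.Theorems.LambertianContactSwapLambertianEulerEntropyToHydro
import Summits.AtomisticToContinuum.HydrodynamicLimit.Theorems.LambertianContactSwapLambertianEulerWindow
import Summits.AtomisticToContinuum.HydrodynamicLimit.Theorems.LambertianContactSwapLambertianEulerMarkov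
import Summits.AtomisticToContinuum.HydrodynamicLimit.Theorems.LambertianContactSwapLambertianEulerIterate
import Summits.AtomisticToContinuum.HydrodynamicLimit.Theorems.LambertianContactSwapLambertianEulerDock
import Summits.AtomisticToContinuum.HydrodynamicLimit.Theorems.LambertianContactSwapLambertianEulerKlLedger
import Summits.AtomisticToContinuum.HydrodynamicLimit.Theorems.LambertianContactSwapLambertianEulerLawSemigroup
import Summits.AtomisticToContinuum.HydrodynamicLimit.Theorems.LambertianContactSwapLambertianEulerDockRf
import Summits.AtomisticToContinuum.HydrodynamicLimit.Theorems.LambertianContactSwapLambertianEulerLambertDirMean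
import Summits.AtomisticToContinuum.HydrodynamicLimit.Theorems.LambertianContactSwapLambertianEulerPairMeanSq
import Summits.AtomisticToContinuum.HydrodynamicLimit.Theorems.LambertianContactSwapLambertianEulerPathwiseProduction
import Summits.AtomisticToContinuum.HydrodynamicLimit.Theorems.LambertianContactSwapLambertianEulerWindowLedger
import Summits.AtomisticToContinuum.HydrodynamicLimit.Theorems.LambertianContactSwapLambertianEulerCollisionCompensator
import Summits.AtomisticToContinuum.HydrodynamicLimit.Theorems.LambertianContactSwapLambertianEulerCompensatedJump
import Summits.AtomisticToContinuum.HydrodynamicLimit.Theorems.LambertianContactSwapLambertianEulerAprioriEntropyBound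
import Summits.AtomisticToContinuum.HydrodynamicLimit.Theorems.LambertianContactSwapLambertianEulerCollisionIntensity
import Summits.AtomisticToContinuum.HydrodynamicLimit.Theorems.LambertianContactSwapLambertianEulerTwoTimeLaw
import Summits.AtomisticToContinuum.HydrodynamicLimit.Theorems.LambertianContactSwapLambertianEulerCollisionBudget
import Summits.AtomisticToContinuum.HydrodynamicLimit.Theorems.LambertianContactSwapLambertianEulerExpectedWindowProductionTools
import Summits.AtomisticToContinuum.HydrodynamicLimit.Theorems.LambertianContactSwapLambertianEulerExpectedWindowProduction
import Summits.AtomisticToContinuum.HydrodynamicLimit.Theorems.LambertianContactSwapLambertianEulerProductionSplit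
import Summits.AtomisticToContinuum.HydrodynamicLimit.Theorems.TwoClocksClampedEntropyClockTimeZeroReference
import Summits.AtomisticToContinuum.HydrodynamicLimit.Theorems.TwoClocksClampedEntropyClockDiscreteEntropyGronwall
import Summits.AtomisticToContinuum.HydrodynamicLimit.Theorems.TwoClocksClampedEntropyClockKlDivLawAtLocalGibbsNeTop
import Literature.MathematicalPhysics.KineticTheory.LambertianRedrawNondegenerate
import Literature.MathematicalPhysics.KineticTheory.Hilbert6Wave0Proofs
import Literature.MathematicalPhysics.KineticTheory.HardSphereEulerLLN
import Literature.Barriers.AtomisticToContinuum.HighMomentumCutoff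
import Literature.Analysis.FluidPDE.HardSphereAlexander
import HarnessLib

/-! TTRL-lite variant V12904 of stmt-AtomisticToContinuum-11854 -/

namespace Summit.AtomisticToContinuum.HydrodynamicLimit.Theorems

open scoped BigOperators Topology ENNReal InnerProductSpace
open MeasureTheory ProbabilityTheory Filter Set InformationTheory
open Literature.MathematicalPhysics.KineticTheory
open Literature.Analysis.FluidPDE Literature.Analysis.FluidPDE.Alexander
open Summit.AtomisticToContinuum.HydrodynamicLimit.Theses.LambertianContactSwap
open Summit.AtomisticToContinuum.HydrodynamicLimit.Theorems.ClampedCurrentsDockPathwise (gSum DgSum)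

/-- Chopping step (TTRL-lite variant V12904 of `stub_kineticOneBlockInMeanLambda`): for an
interval-additive `Y` (cocycle `Y a c = Y a b + Y b c`), `m` consecutive window bounds of
length `h` starting at `s` sum to the corresponding bound on `[s, s + m h]`.  Proof by
induction on `m`; the case `m = 0` uses `Y s s = 0`, which follows from the cocycle. -/
theorem stub_kineticOneBlockInMeanLambda_var12904 :
    ∀ (m : ℕ) (s h C M δ : ℝ) (Y : ℝ → ℝ → ℝ), (∀ a b c : ℝ, Y a c = Y a b + Y b c) →
      (∀ i : ℕ, i < m → -(Y (s + (i : ℝ) * h) (s + ((i : ℝ) + 1) * h)) ≤ C * h * M + δ * h) →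
      -(Y s (s + (m : ℝ) * h)) ≤ (m : ℝ) * (C * h * M + δ * h) := by
  intro m
  induction m with
  | zero =>
    intro s h C M δ Y hY _
    have h0 := hY s s s
    simp only [Nat.cast_zero, zero_mul, add_zero]
    linarith
  | succ n ih =>
    intro s h C M δ Y hY hw
    have ih' := ih s h C M δ Y hY (fun i hi => hw i (Nat.lt_succ_of_lt hi))
    have hn := hw n (Nat.lt_succ_self n)
    have hsplit := hY s (s + (n : ℝ) * h) (s + ((n : ℝ) + 1) * h)
    push_cast
    linarith

end Summit.AtomisticToContinuum.HydrodynamicLimit.Theorems
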